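import Literature.Computability.AlgebraicComplexity.MatMulBorderRankCertificate
import HarnessLib

/-!
# `bR(⟨2,3,5⟩) ≤ 24 < 25 = R`: Smirnov's `⟨2,3,3; 14⟩` ⊕ Bini et al.'s `⟨2,3,2; 10⟩`, kernel-checked (census cell, derived)

Topic `Summits/MatrixMultiplication/OmegaCensus/SmallFormats` (cell pub-omega, family (a), border-rank
column of the small-format census).  Framing: lottery ticket; floor = certified bounds/negative ranges.
This is a DERIVED cell, not a published statement (hence under `Summits/`, per the placement rule): the
bound follows from PUBLISHED approximate algorithms by the subadditivity of border rank under direct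
sums / block gluing (Bürgisser–Clausen–Shokrollahi 1997, §15.2), and is certified here directly by ONE
kernel-checked approximate decomposition obtained by placing the published schemes on complementary
blocks (coefficients from Benson–Ballard's *fast-matmul*, `codegen/algorithms/*-approx`; the assembled
identity was confirmed in exact rational arithmetic and in integer arithmetic before transcription — the
kernel check IS the proof).  Toolkit: `Literature/…/MatMulBorderRankCertificate.lean`
(`ApproxCert.checkRow`, `ptab`, `algBorderRank_matMulTensor_le_of_check`).

THE CELL: `⟨2,3,5⟩` (a `2 × 3` by a `3 × 5` matrix).  Exact rank record `R ≤ 25` (Hopcroft–Kerr 1971;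
kernel `tensorRank_matMulTensor_235_le`), lower bound `22 ≤ R` (Lafon–Winograd, kernel).  Border rank:
splitting the five columns as `3 + 2`, `⟨2,3,5⟩ = ⟨2,3,3⟩ ⊕ ⟨2,3,2⟩`, and `R̲(⟨2,3,3⟩) ≤ 14` (Smirnov
2013, Table 4; kernel `Smirnov2013_algBorderRank_matMulTensor_233_le`), `R̲(⟨2,3,2⟩) ≤ 10` (Bini–
Capovani–Romani–Lotti 1979; kernel `BCRL1979_algBorderRank_matMulTensor_223_le` up to rotation) give
**`R̲(⟨2,3,5⟩) ≤ 24`**, one below the exact rank.  The certificate: `24` triads = fast-matmul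
`smirnov233-14-108-approx` on the columns `1–3` and `bini232-10-52-approx` on the columns `4–5`
(order `3`, multiplier `1`).

* `M235.cU / cV / cW`, `row_0 … row_9`, `check` (`ApproxCert.check 10 6 15 24 3 1 (matMulFlat 2 3 5) …`);
* `approxRank_three_matMulTensor_235_le`, `algBorderRank_matMulTensor_235_le / _352_le / _523_le`.

## References

* [Smirnov2013] A. V. Smirnov, Comput. Math. Math. Phys. 53 (2013) 1781–1795 — Table 4 (`⟨3,2,3;14⟩`).
* [BiniCapovaniRomaniLotti1979] D. Bini, M. Capovani, F. Romani, G. Lotti, Inform. Process. Lett. 8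
  (1979) 234–235 — `⟨3,2,2; 10⟩` approximate.
* [BurgisserClausenShokrollahi1997] BCS 1997, §15.2 (border rank subadditive).
* [BensonBallard2015] fast-matmul coefficient files.
-/

noncomputable section

open scoped BigOperators

namespace Summit.MatrixMultiplication.OmegaCensus.BorderRankAdditive

open Literature.Computability.AlgebraicComplexity

namespace M235

/-! ## The data: `24` triads of polynomial vectors over `ℤ` (product-major; entry = ascending coefficient list) -/

/-- `Uₜ ∈ ℤ[ε]^{2×5}` (`t = 1, …, 24`): the vectors on the product slot `C = AB` (flat row-major position `l + 5·i` of the entry `(i,l)`), as ascending coefficient lists. [cite: BensonBallard2015, files codegen/algorithms/smirnov233-14-108-approx and bini232-10-52-approx] [cite: Smirnov2013, Table 4] [cite: BiniCapovaniRomaniLotti1979, main result] -/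
def cU : List (List (List ℤ)) :=
  [[[], [1], [], [], [], [], [], [], [], []],
   [[1], [], [], [], [], [], [], [], [], []],
   [[1], [], [0, 0, 1], [], [], [], [], [0, 0, -1], [], []],
   [[0, 0, 1], [0, 0, 1], [0, 0, 0, 1], [], [], [], [], [], [], []],
   [[-1], [], [], [], [], [], [], [0, 0, 1], [], []],
   [[-1], [], [], [], [], [], [0, 1], [], [], []],
   [[1], [], [], [], [], [0, 0, 1], [], [], [], []],
   [[], [-1], [], [], [], [1], [], [], [], []],
   [[], [], [], [], [], [], [0, 1], [], [], []],
   [[], [1], [0, 0, 1], [], [], [], [], [0, 0, -1], [], []],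
   [[], [-1], [], [], [], [], [], [0, 0, 1], [], []],
   [[], [], [], [], [], [1], [], [], [], []],
   [[], [1], [], [], [], [], [0, 0, 1], [], [], []],
   [[], [], [], [], [], [0, 0, -1], [0, 0, -1], [0, 0, 0, 1], [], []],
   [[], [], [], [0, 0, 0, 1], [], [], [], [], [], [0, 0, 1]],
   [[], [], [], [], [], [], [], [], [0, 0, -1], [0, 0, -1]],
   [[], [], [], [], [], [], [], [], [], [0, 0, 1]],
   [[], [], [], [0, 0, 0, -1], [], [], [], [], [0, 0, 1], []],
   [[], [], [], [], [0, 0, 0, 1], [], [], [], [], [0, 0, 1]],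
   [[], [], [], [0, 0, 1], [], [], [], [], [], [0, 0, 0, 1]],
   [[], [], [], [0, 0, 1], [], [], [], [], [], []],
   [[], [], [], [0, 0, -1], [0, 0, -1], [], [], [], [], []],
   [[], [], [], [0, 0, 1], [], [], [], [], [0, 0, 0, 1], []],
   [[], [], [], [], [0, 0, 1], [], [], [], [], [0, 0, 0, -1]]]

/-- `Vₜ ∈ ℤ[ε]^{2×3}`: the vectors on the left-factor slot `A` (flat position `j + 3·i` of `(i,j)`). [cite: BensonBallard2015, files codegen/algorithms/smirnov233-14-108-approx and bini232-10-52-approx] [cite: Smirnov2013, Table 4] [cite: BiniCapovaniRomaniLotti1979, main result] -/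
def cV : List (List (List ℤ)) :=
  [[[], [0, 0, 1], [], [1], [], []],
   [[], [], [0, 0, 0, 1], [1], [], [0, -1]],
   [[-1], [], [0, 1, 0, 1], [], [], []],
   [[], [1], [], [], [], []],
   [[-1], [], [0, 1], [-1], [], [0, 1]],
   [[], [0, 0, -1], [0, 0, 0, -1], [-1], [], [0, 1]],
   [[], [0, 0, 0, 0, 1], [], [-1], [], [0, 1]],
   [[], [], [], [-1], [], []],
   [[], [0, 0, 1], [0, 0, 0, 1], [1], [0, -1], [0, -1]],
   [[1], [], [], [], [], []],
   [[1], [0, 0, 1], [], [1], [], []],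
   [[], [], [], [1], [0, 0, 1], []],
   [[], [0, 0, 1, 1], [0, 0, 0, 1], [1], [], []],
   [[], [], [], [], [1], []],
   [[1], [], [], [], [1], []],
   [[], [], [], [], [1], []],
   [[1], [], [], [], [], []],
   [[], [], [], [0, 1], [1], []],
   [[1], [], [], [0, 1], [], []],
   [[], [1], [], [], [], [1]],
   [[], [], [], [], [], [1]],
   [[], [1], [], [], [], []],
   [[], [], [0, 1], [], [], [1]],
   [[], [1], [0, 1], [], [], []]]

/-- `Wₜ ∈ ℤ[ε]^{3×5}`: the vectors on the right-factor slot `B` (flat position `l + 5·j` of `(j,l)`). [cite: BensonBallard2015, files codegen/algorithms/smirnov233-14-108-approx and bini232-10-52-approx] [cite: Smirnov2013, Table 4] [cite: BiniCapovaniRomaniLotti1979, main result] -/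
def cW : List (List (List ℤ)) :=
  [[[], [0, -1], [0, 1], [], [], [0, -1], [0, 1], [-1], [], [], [0, 0, 1], [-1], [1], [], []],
   [[0, 0, 1], [], [0, 0, 0, -1], [], [], [], [], [1], [], [], [1], [0, -1], [-1], [], []],
   [[0, 0, 0, -1], [], [0, 0, 0, 1], [], [], [], [], [], [], [], [], [], [1], [], []],
   [[], [], [], [], [], [0, 1], [], [1], [], [], [0, 0, -1], [0, -1], [], [], []],
   [[], [], [0, 0, 0, 1], [], [], [], [], [], [], [], [], [], [1], [], []],
   [[], [], [], [], [], [], [], [-1], [], [], [], [0, 1], [], [], []],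
   [[0, 0, 1], [], [], [], [], [], [], [], [], [], [1], [], [], [], []],
   [[], [], [], [], [], [0, 1], [0, -1], [1], [], [], [0, 0, -1], [], [], [], []],
   [[], [], [], [], [], [], [], [-1], [], [], [], [], [], [], []],
   [[], [0, 0, 0, 1], [0, 1], [], [], [], [], [], [], [], [], [], [1], [], []],
   [[], [], [0, 1], [], [], [], [], [], [], [], [], [], [1], [], []],
   [[0, 0, 0, 1, 1], [], [], [], [], [0, 1], [0, -1], [1], [], [], [], [], [], [], []],
   [[], [0, 1], [], [], [], [], [], [], [], [], [], [1], [], [], []],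
   [[], [], [], [], [], [], [0, -1], [1], [], [], [], [], [], [], []],
   [[], [], [], [1], [], [], [], [], [], [0, 1], [], [], [], [], []],
   [[], [], [], [1], [], [], [], [], [], [], [], [], [], [], []],
   [[], [], [], [-1], [-1], [], [], [], [], [], [], [], [], [], []],
   [[], [], [], [1], [], [], [], [], [0, 1], [], [], [], [], [], []],
   [[], [], [], [], [1], [], [], [], [], [0, -1], [], [], [], [], []],
   [[], [], [], [], [], [], [], [], [0, 1], [], [], [], [], [], [1]],
   [[], [], [], [], [], [], [], [], [], [], [], [], [], [-1], [-1]],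
   [[], [], [], [], [], [], [], [], [], [], [], [], [], [], [1]],
   [[], [], [], [], [], [], [], [], [0, -1], [], [], [], [], [1], []],
   [[], [], [], [], [], [], [], [], [], [0, 1], [], [], [], [], [1]]]

/-! ## The finite check, one kernel evaluation per `C`-coordinate (`ApproxCert.checkRow`) -/

/-- Row `0` of the certificate check (entries `(0, j, l)`, degrees `0, …, 3`). [cite: BurgisserClausenShokrollahi1997, §15.2 (subadditivity)] [cite: Smirnov2013, Table 4] [cite: BiniCapovaniRomaniLotti1979, main result] -/
theorem row_0 : ApproxCert.checkRow 10 6 15 24 3 1 (matMulFlat 2 3 5) (ptab cU) (ptab cV) (ptab cW) ⟨0, by decide⟩ = true := by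
  decide +kernel

/-- Row `1` of the certificate check (entries `(1, j, l)`, degrees `0, …, 3`). [cite: BurgisserClausenShokrollahi1997, §15.2 (subadditivity)] [cite: Smirnov2013, Table 4] [cite: BiniCapovaniRomaniLotti1979, main result] -/
theorem row_1 : ApproxCert.checkRow 10 6 15 24 3 1 (matMulFlat 2 3 5) (ptab cU) (ptab cV) (ptab cW) ⟨1, by decide⟩ = true := by
  decide +kernel

/-- Row `2` of the certificate check (entries `(2, j, l)`, degrees `0, …, 3`). [cite: BurgisserClausenShokrollahi1997, §15.2 (subadditivity)] [cite: Smirnov2013, Table 4] [cite: BiniCapovaniRomaniLotti1979, main result] -/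
theorem row_2 : ApproxCert.checkRow 10 6 15 24 3 1 (matMulFlat 2 3 5) (ptab cU) (ptab cV) (ptab cW) ⟨2, by decide⟩ = true := by
  decide +kernel

/-- Row `3` of the certificate check (entries `(3, j, l)`, degrees `0, …, 3`). [cite: BurgisserClausenShokrollahi1997, §15.2 (subadditivity)] [cite: Smirnov2013, Table 4] [cite: BiniCapovaniRomaniLotti1979, main result] -/
theorem row_3 : ApproxCert.checkRow 10 6 15 24 3 1 (matMulFlat 2 3 5) (ptab cU) (ptab cV) (ptab cW) ⟨3, by decide⟩ = true := by
  decide +kernel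

/-- Row `4` of the certificate check (entries `(4, j, l)`, degrees `0, …, 3`). [cite: BurgisserClausenShokrollahi1997, §15.2 (subadditivity)] [cite: Smirnov2013, Table 4] [cite: BiniCapovaniRomaniLotti1979, main result] -/
theorem row_4 : ApproxCert.checkRow 10 6 15 24 3 1 (matMulFlat 2 3 5) (ptab cU) (ptab cV) (ptab cW) ⟨4, by decide⟩ = true := by
  decide +kernel

/-- Row `5` of the certificate check (entries `(5, j, l)`, degrees `0, …, 3`). [cite: BurgisserClausenShokrollahi1997, §15.2 (subadditivity)] [cite: Smirnov2013, Table 4] [cite: BiniCapovaniRomaniLotti1979, main result] -/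
theorem row_5 : ApproxCert.checkRow 10 6 15 24 3 1 (matMulFlat 2 3 5) (ptab cU) (ptab cV) (ptab cW) ⟨5, by decide⟩ = true := by
  decide +kernel

/-- Row `6` of the certificate check (entries `(6, j, l)`, degrees `0, …, 3`). [cite: BurgisserClausenShokrollahi1997, §15.2 (subadditivity)] [cite: Smirnov2013, Table 4] [cite: BiniCapovaniRomaniLotti1979, main result] -/
theorem row_6 : ApproxCert.checkRow 10 6 15 24 3 1 (matMulFlat 2 3 5) (ptab cU) (ptab cV) (ptab cW) ⟨6, by decide⟩ = true := by
  decide +kernel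

/-- Row `7` of the certificate check (entries `(7, j, l)`, degrees `0, …, 3`). [cite: BurgisserClausenShokrollahi1997, §15.2 (subadditivity)] [cite: Smirnov2013, Table 4] [cite: BiniCapovaniRomaniLotti1979, main result] -/
theorem row_7 : ApproxCert.checkRow 10 6 15 24 3 1 (matMulFlat 2 3 5) (ptab cU) (ptab cV) (ptab cW) ⟨7, by decide⟩ = true := by
  decide +kernel

/-- Row `8` of the certificate check (entries `(8, j, l)`, degrees `0, …, 3`). [cite: BurgisserClausenShokrollahi1997, §15.2 (subadditivity)] [cite: Smirnov2013, Table 4] [cite: BiniCapovaniRomaniLotti1979, main result] -/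
theorem row_8 : ApproxCert.checkRow 10 6 15 24 3 1 (matMulFlat 2 3 5) (ptab cU) (ptab cV) (ptab cW) ⟨8, by decide⟩ = true := by
  decide +kernel

/-- Row `9` of the certificate check (entries `(9, j, l)`, degrees `0, …, 3`). [cite: BurgisserClausenShokrollahi1997, §15.2 (subadditivity)] [cite: Smirnov2013, Table 4] [cite: BiniCapovaniRomaniLotti1979, main result] -/
theorem row_9 : ApproxCert.checkRow 10 6 15 24 3 1 (matMulFlat 2 3 5) (ptab cU) (ptab cV) (ptab cW) ⟨9, by decide⟩ = true := by
  decide +kernel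

/-- **The whole certificate checks**: `∑ₜ Uₜ ⊗ Vₜ ⊗ Wₜ = ε^3 · ⟨2,3,5⟩ + O(ε^4)` (flat format). [cite: BurgisserClausenShokrollahi1997, §15.2 (subadditivity)] [cite: Smirnov2013, Table 4] [cite: BiniCapovaniRomaniLotti1979, main result] -/
theorem check : ApproxCert.check 10 6 15 24 3 1 (matMulFlat 2 3 5) (ptab cU) (ptab cV) (ptab cW) = true :=
  ApproxCert.check_of_forall_checkRow fun i => by
    fin_cases i
    exacts [row_0, row_1, row_2, row_3, row_4, row_5, row_6, row_7, row_8, row_9]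

end M235


/-! ## The bounds -/

section Bounds

variable (K : Type*) [CommRing K]

/-- **`R₃(⟨2,3,5⟩) ≤ 24`** over every commutative ring (derived: direct sum of two published schemes).
[cite: BurgisserClausenShokrollahi1997, §15.2 (subadditivity)] [cite: Smirnov2013, Table 4]
[cite: BiniCapovaniRomaniLotti1979, main result] -/
theorem approxRank_three_matMulTensor_235_le : approxRank 3 (matMulTensor K 2 3 5) ≤ 24 :=
  approxRank_matMulTensor_le_of_check K M235.check (by simp)

/-- **`bR(⟨2,3,5⟩) ≤ 24`** over every commutative ring (census cell; exact rank record is `25`).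
[cite: BurgisserClausenShokrollahi1997, §15.2 (subadditivity)] [cite: Smirnov2013, Table 4]
[cite: BiniCapovaniRomaniLotti1979, main result] -/
theorem algBorderRank_matMulTensor_235_le : algBorderRank (matMulTensor K 2 3 5) ≤ 24 :=
  algBorderRank_matMulTensor_le_of_check K M235.check (by simp)

/-- **`bR(⟨3,5,2⟩) ≤ 24`** (cyclic rotation). [cite: BurgisserClausenShokrollahi1997, §15.2 (subadditivity)] -/
theorem algBorderRank_matMulTensor_352_le : algBorderRank (matMulTensor K 3 5 2) ≤ 24 :=
  (algBorderRank_le_approxRank 3 _).trans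
    ((approxRank_matMulTensor_rotate_le K 3 2 3 5).trans (approxRank_three_matMulTensor_235_le K))

/-- **`bR(⟨5,2,3⟩) ≤ 24`** (the third cyclic format). [cite: BurgisserClausenShokrollahi1997, §15.2 (subadditivity)] -/
theorem algBorderRank_matMulTensor_523_le : algBorderRank (matMulTensor K 5 2 3) ≤ 24 :=
  (algBorderRank_le_approxRank 3 _).trans
    ((approxRank_matMulTensor_rotate_le K 3 3 5 2).trans
      ((approxRank_matMulTensor_rotate_le K 3 2 3 5).trans (approxRank_three_matMulTensor_235_le K)))

end Bounds

end Summit.MatrixMultiplication.OmegaCensus.BorderRankAdditive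

end
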